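import Mathlib
import Literature.AlgebraicGeometry.HyperbolicPolynomials.HyperbolicityCone
import Literature.AlgebraicGeometry.HyperbolicPolynomials.Garding
import Literature.AlgebraicGeometry.HyperbolicPolynomials.SmoothBoundary
import Summits.ValiantsHypothesis.ValiantsHypothesis.Theorems.PermanentalConesPermanentalConeHardGardingGradient
import Summits.ValiantsHypothesis.ValiantsHypothesis.Theorems.PermanentalConesPermanentalConeHardKnapsackSpan
import Summits.ValiantsHypothesis.ValiantsHypothesis.Theorems.PermanentalConesPermanentalConeHardKnapsackSandwich

/-!
# `PermanentalConeHard` (stmt-ValiantsHypothesis-8654), line `birth` — no exact LRS zero pattern in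
gradient slack matrices of low-degree hyperbolicity cones

Route `PermanentalCones` of `ValiantsHypothesis`, crux `PermanentalConeHard` (H+), core stub
`stub_permanentalGradientPsdRank`: the gradient slack matrices `S[i,k] = gradForm Q (z_k) (x_i) =
⟨∇Q(z_k), x_i⟩` of some nonnegative permanental cone must have super-quasi-polynomial psd-rank.
The only engine in print is the Lee–Raghavendra–Steurer bound for the knapsack pattern matrices
`M_n^f(S, a) = f(a_S)` (arXiv:1411.6317), whose ZERO PATTERN is `f(a_S) = 0 ⟺ |a ∩ S| ∈ {k, k+1}`
(`m = 2k+1`).  This file is the no-go theorem in the core stub's own language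
(`stub_noKnapsackZeroPatternEmbedding`): if, for a homogeneous `Q` hyperbolic w.r.t. `𝟙` with
`Q(𝟙) > 0` (e.g. any nonnegative permanental `Q_N`), row points `x_a = Φ v_a ∈ Λ₊(Q,𝟙)` depending
linearly on the degree-2 moment vectors `v_a` of the cube points and column points
`z_S ∈ Λ₊(Q,𝟙)` reproduce that zero pattern — `⟨∇Q(z_S), Φ v_a⟩ = 0` exactly when
`|a ∩ S| ∈ {k,k+1}`, the column being not identically zero — and the image of `Φ` meets the open
cone, then `C(n,m) ≤ deg Q`.  For the permanental family `deg Q_N ≤ N`, so an exact embedding of the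
LRS matrices (in particular with `m ≍ n^{2/13}` as LRS need) forces `N ≥ C(n,m)`, super-polynomial in
`n`: the exact transfer of the LRS bound to the core stub is impossible (lead c2,
`Cruxes/PermanentalConeHard/CORE-analysis-c2.md` §3).  Proof: the pulled-back gradient covector
`Φᵀ∇Q(z_S)` kills the contact moment vectors, hence is a multiple of the knapsack covector `f_S`
(`stub_knapsackContactSpan`), a positive one by Gårding's sign and the value at `a = ∅`; so the
pull-back cone `Λ₊(Q∘Φ)` is sandwiched between the correlation cone and the knapsack relaxation, and
`stub_noExactKnapsackSandwich` applies to `Q∘Φ` (degree `deg Q`).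
-/

set_option linter.dupNamespace false

namespace Summit.ValiantsHypothesis.ValiantsHypothesis.Theorems.PermanentalConesPermanentalConeHard

open Finset MvPolynomial
open scoped BigOperators Matrix
open Literature.AlgebraicGeometry.HyperbolicPolynomials

namespace KnapsackZeroPattern

variable {n : ℕ}

/-- A covector on the moment space that kills every contact moment vector
(`|A ∩ S| ∈ {k, k+1}`, `|S| = 2k+1 ≥ 3`) is a multiple of the knapsack covector `f_S`
(coordinate form of `stub_knapsackContactSpan`). [folklore] -/
theorem covector_eq_smul_knapsack {k : ℕ} (hk : 1 ≤ k) {S : Finset (Fin n)}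
    (hS : S.card = 2 * k + 1) (c : Option (Fin n ⊕ {p : Fin n × Fin n // p.1 < p.2}) → ℝ)
    (hc : ∀ A : Finset (Fin n), ((A ∩ S).card = k ∨ (A ∩ S).card = k + 1) →
      dotProduct c (fun o : Option (Fin n ⊕ {p : Fin n × Fin n // p.1 < p.2}) =>
        Option.elim o (1 : ℝ) (Sum.elim (fun i => if i ∈ A then (1 : ℝ) else 0)
          (fun p => if p.1.1 ∈ A ∧ p.1.2 ∈ A then (1 : ℝ) else 0))) = 0) :
    ∃ t : ℝ, c = t • (fun o : Option (Fin n ⊕ {p : Fin n × Fin n // p.1 < p.2}) =>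
      Option.elim o ((k : ℝ) * ((k : ℝ) + 1))
        (Sum.elim (fun i => if i ∈ S then -(2 * (k : ℝ)) else 0)
          (fun p => if p.1.1 ∈ S ∧ p.1.2 ∈ S then (2 : ℝ) else 0))) := by
  classical
  set c₂ : Fin n → Fin n → ℝ := fun i j => if h : i < j then c (some (Sum.inr ⟨(i, j), h⟩)) else 0
    with hc₂
  have hzero : ∀ A : Finset (Fin n), ((A ∩ S).card = k ∨ (A ∩ S).card = k + 1) →
      c none + (∑ i ∈ A, c (some (Sum.inl i))) +
        (∑ i ∈ A, ∑ j ∈ A, if i < j then c₂ i j else 0) = 0 := by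
    intro A hA
    have h0 := hc A hA
    rw [KnapsackSandwich.dotProduct_momentVec] at h0
    have hsame : ∀ i j : Fin n, (if i < j then c₂ i j else 0) =
        (if h : i < j then c (some (Sum.inr ⟨(i, j), h⟩)) else 0) := by
      intro i j
      rw [hc₂]
      dsimp only
      split_ifs <;> rfl
    simp_rw [hsame]
    exact h0
  obtain ⟨t, ht0, ht1, ht2⟩ := stub_knapsackContactSpan n k S hk hS (c none)
    (fun i => c (some (Sum.inl i))) c₂ hzero
  refine ⟨t, funext fun o => ?_⟩
  rcases o with _ | ⟨i⟩ | ⟨⟨⟨i, j⟩, hij⟩⟩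
  · simp only [Pi.smul_apply, Option.elim_none, smul_eq_mul]
    rw [ht0]
  · simp only [Pi.smul_apply, Option.elim_some, Sum.elim_inl, smul_eq_mul]
    rw [ht1 i]
    split_ifs <;> ring
  · simp only [Pi.smul_apply, Option.elim_some, Sum.elim_inr, smul_eq_mul]
    have h2 := ht2 i j hij
    rw [hc₂] at h2
    dsimp only at h2
    rw [dif_pos hij] at h2
    rw [h2]
    split_ifs <;> ring

/-- The linear pull-back of a homogeneous polynomial along a matrix is homogeneous of the same
degree. [folklore] -/
theorem isHomogeneous_bind₁_linear {σ ι : Type*} [Fintype ι] {Q : MvPolynomial σ ℝ} {d : ℕ}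
    (hQ : Q.IsHomogeneous d) (Φ : Matrix σ ι ℝ) :
    (bind₁ (fun i => ∑ o, C (Φ i o) * X o) Q).IsHomogeneous d := by
  have h := hQ.aeval (fun i => ∑ o, C (Φ i o) * X o) (n := 1) (fun i => ?_)
  · simpa only [one_mul, MvPolynomial.aeval_eq_bind₁] using h
  · refine IsHomogeneous.sum _ _ _ fun o _ => ?_
    simpa using (isHomogeneous_C ι (Φ i o)).mul (isHomogeneous_X ℝ o)

end KnapsackZeroPattern

open KnapsackZeroPattern in
/-- Registered form (`stub_noKnapsackZeroPatternEmbedding`, no-go infrastructure stub of the core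
`stub_permanentalGradientPsdRank`): **gradient slack matrices of low-degree hyperbolicity cones do
not contain the Lee–Raghavendra–Steurer knapsack zero pattern.**  Let `Q` be homogeneous of degree
`dQ`, hyperbolic w.r.t. `𝟙` with `Q(𝟙) > 0`; let the row points be `Φ v_A ∈ Λ₊(Q,𝟙)` for the
degree-2 moment vectors `v_A` of all `A ⊆ Fin n` (Φ a linear map of the moment space whose image
meets the open cone), and suppose that for every `S` with `|S| = 2k+1 ≥ 3` some column point
`z_S ∈ Λ₊(Q,𝟙)` has `⟨∇Q(z_S), Φ v_A⟩ = 0` for all contact sets `|A ∩ S| ∈ {k,k+1}` and `≠ 0` for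
some `A` (the zero pattern of the LRS pattern matrix `M_n^f`, knapsack `f`).  Then
`C(n, 2k+1) ≤ dQ`.  For the permanental cones `dQ ≤ N` (number of variable rows), so exact
embeddings need `N ≥ C(n,m)` — super-polynomial for the `m → ∞` that LRS require.
[folklore; from `stub_knapsackContactSpan`, Gårding's sign lemma `stub_gardingGradient`, and the
facet-contact obstruction `stub_noExactKnapsackSandwich` applied to `Q ∘ Φ`] -/
theorem stub_noKnapsackZeroPatternEmbedding :
    ∀ (n k : ℕ), 1 ≤ k → ∀ (N dQ : ℕ) (Q : MvPolynomial (Fin N) ℝ), Q.IsHomogeneous dQ →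
      IsHyperbolic Q (fun _ => (1 : ℝ)) → 0 < MvPolynomial.eval (fun _ => (1 : ℝ)) Q →
      ∀ (Φ : Matrix (Fin N) (Option (Fin n ⊕ {p : Fin n × Fin n // p.1 < p.2})) ℝ)
        (e' : Option (Fin n ⊕ {p : Fin n × Fin n // p.1 < p.2}) → ℝ),
        Φ *ᵥ e' ∈ openHyperbolicityCone Q (fun _ => (1 : ℝ)) →
        (∀ A : Finset (Fin n), Φ *ᵥ (fun o : Option (Fin n ⊕ {p : Fin n × Fin n // p.1 < p.2}) =>
          Option.elim o (1 : ℝ) (Sum.elim (fun i => if i ∈ A then (1 : ℝ) else 0)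
            (fun p => if p.1.1 ∈ A ∧ p.1.2 ∈ A then (1 : ℝ) else 0))) ∈
            hyperbolicityCone Q (fun _ => (1 : ℝ))) →
        (∀ S : Finset (Fin n), S.card = 2 * k + 1 →
          ∃ z ∈ hyperbolicityCone Q (fun _ => (1 : ℝ)),
            (∀ A : Finset (Fin n), ((A ∩ S).card = k ∨ (A ∩ S).card = k + 1) →
              gradForm Q z (Φ *ᵥ (fun o : Option (Fin n ⊕ {p : Fin n × Fin n // p.1 < p.2}) =>
                Option.elim o (1 : ℝ) (Sum.elim (fun i => if i ∈ A then (1 : ℝ) else 0)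
                  (fun p => if p.1.1 ∈ A ∧ p.1.2 ∈ A then (1 : ℝ) else 0)))) = 0) ∧
            (∃ A : Finset (Fin n),
              gradForm Q z (Φ *ᵥ (fun o : Option (Fin n ⊕ {p : Fin n × Fin n // p.1 < p.2}) =>
                Option.elim o (1 : ℝ) (Sum.elim (fun i => if i ∈ A then (1 : ℝ) else 0)
                  (fun p => if p.1.1 ∈ A ∧ p.1.2 ∈ A then (1 : ℝ) else 0)))) ≠ 0)) →
        n.choose (2 * k + 1) ≤ dQ := by
  intro n k hk N dQ Q hhom hhyp hpos Φ e' he' hvA hzS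
  classical
  set v : Finset (Fin n) → Option (Fin n ⊕ {p : Fin n × Fin n // p.1 < p.2}) → ℝ :=
    fun A o => Option.elim o (1 : ℝ) (Sum.elim (fun i => if i ∈ A then (1 : ℝ) else 0)
      (fun p => if p.1.1 ∈ A ∧ p.1.2 ∈ A then (1 : ℝ) else 0)) with hv
  set w : Finset (Fin n) → Option (Fin n ⊕ {p : Fin n × Fin n // p.1 < p.2}) → ℝ :=
    fun S o => Option.elim o ((k : ℝ) * ((k : ℝ) + 1))
      (Sum.elim (fun i => if i ∈ S then -(2 * (k : ℝ)) else 0)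
        (fun p => if p.1.1 ∈ S ∧ p.1.2 ∈ S then (2 : ℝ) else 0)) with hw
  -- the pull-back `q = Q ∘ Φ`, hyperbolic w.r.t. `e'`, homogeneous of degree `dQ`
  set q : MvPolynomial (Option (Fin n ⊕ {p : Fin n × Fin n // p.1 < p.2})) ℝ :=
    bind₁ (fun i => ∑ o, C (Φ i o) * X o) Q with hq
  have hq_hom : q.IsHomogeneous dQ := isHomogeneous_bind₁_linear hhom Φ
  have hdir : IsHyperbolic Q (Φ *ᵥ e') := hhyp.of_mem_openHyperbolicityCone hhom he'
  have hq_hyp : IsHyperbolic q e' := IsHyperbolic.bind₁_linear Φ hdir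
  have hcone_eq : hyperbolicityCone Q (Φ *ᵥ e') = hyperbolicityCone Q (fun _ => (1 : ℝ)) :=
    hyperbolicityCone_eq_of_mem hhom hhyp he'
  have hmem_q : ∀ y, y ∈ hyperbolicityCone q e' ↔ Φ *ᵥ y ∈ hyperbolicityCone Q (fun _ => (1 : ℝ)) := by
    intro y
    rw [hq, hyperbolicityCone_bind₁_linear, Set.mem_preimage, hcone_eq]
  -- the moment vectors lie in the pull-back cone
  have hvA' : ∀ A : Finset (Fin n), v A ∈ hyperbolicityCone q e' := fun A => (hmem_q _).2 (hvA A)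
  -- the knapsack covectors support the pull-back cone
  have hwS : ∀ S : Finset (Fin n), S.card = 2 * k + 1 → ∀ y ∈ hyperbolicityCone q e',
      0 ≤ dotProduct (w S) y := by
    intro S hS y hy
    obtain ⟨z, hz, hzero, ⟨A₁, hA₁⟩⟩ := hzS S hS
    -- the pulled-back gradient covector `ψ = Φᵀ ∇Q(z)` and its coefficient vector `c`
    set ψ : (Option (Fin n ⊕ {p : Fin n × Fin n // p.1 < p.2}) → ℝ) →ₗ[ℝ] ℝ :=
      (gradForm Q z).comp (Matrix.mulVecLin Φ) with hψ
    have hψ_apply : ∀ y', ψ y' = gradForm Q z (Φ *ᵥ y') := fun y' => rfl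
    set c : Option (Fin n ⊕ {p : Fin n × Fin n // p.1 < p.2}) → ℝ :=
      fun o => ψ (fun j => if o = j then 1 else 0) with hc
    have hψc : ∀ y', ψ y' = dotProduct c y' := by
      intro y'
      rw [LinearMap.pi_apply_eq_sum_univ ψ y']
      simp only [dotProduct, hc, smul_eq_mul]
      exact Finset.sum_congr rfl fun o _ => mul_comm _ _
    -- `c` kills the contact moment vectors, hence `c = t • f_S`
    have hkill : ∀ A : Finset (Fin n), ((A ∩ S).card = k ∨ (A ∩ S).card = k + 1) →
        dotProduct c (v A) = 0 := by
      intro A hA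
      rw [← hψc, hψ_apply]
      exact hzero A hA
    obtain ⟨t, ht⟩ := covector_eq_smul_knapsack hk hS c hkill
    have ht' : c = t • w S := ht
    -- Gårding: `ψ ≥ 0` on the pull-back cone
    have hgard : ∀ y' ∈ hyperbolicityCone q e', 0 ≤ ψ y' := by
      intro y' hy'
      rw [hψ_apply]
      exact stub_gardingGradient N dQ Q (fun _ => (1 : ℝ)) hhom hhyp hpos z hz _ ((hmem_q _).1 hy')
    -- the sign of `t`: test on `A = ∅` (value `t·k(k+1) ≥ 0`) and on `A₁` (nonzero)
    have hval0 : dotProduct (w S) (v ∅) = (k : ℝ) * ((k : ℝ) + 1) := by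
      have := KnapsackSandwich.knapsack_dotProduct_momentVec k S (∅ : Finset (Fin n))
      simp only [Finset.empty_inter, Finset.card_empty, Nat.cast_zero, zero_sub] at this
      rw [hw, hv]
      rw [this]
      ring
    have ht_ne : t ≠ 0 := by
      intro h0
      apply hA₁
      rw [← hψ_apply, hψc, ht', h0, zero_smul, zero_dotProduct]
    have ht_nonneg : 0 ≤ t * ((k : ℝ) * ((k : ℝ) + 1)) := by
      have h := hgard (v ∅) (hvA' ∅)
      rwa [hψc, ht', smul_dotProduct, hval0, smul_eq_mul] at h
    have hkk : (0 : ℝ) < (k : ℝ) * ((k : ℝ) + 1) := by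
      have : (1 : ℝ) ≤ k := by exact_mod_cast hk
      positivity
    have ht_pos : 0 < t :=
      lt_of_le_of_ne (nonneg_of_mul_nonneg_left ht_nonneg hkk) (Ne.symm ht_ne)
    -- conclude
    have h := hgard y hy
    rw [hψc, ht', smul_dotProduct, smul_eq_mul] at h
    exact nonneg_of_mul_nonneg_right h ht_pos
  exact stub_noExactKnapsackSandwich n k hk dQ q e' hq_hom hq_hyp hvA' hwS

end Summit.ValiantsHypothesis.ValiantsHypothesis.Theorems.PermanentalConesPermanentalConeHard
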